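import Mathlib
import Summits.KontsevichZagierPeriods.KontsevichZagierPeriods.Theorems.SoloInformedIsogenyChain
import Summits.KontsevichZagierPeriods.KontsevichZagierPeriods.Theorems.SoloInformedEquianharmonicSector
import HarnessLib
import HarnessLib.Audit

/-!
# SoloInformed — the isogeny sector `ℤ[⟦[pt,√3]⟧, ⟦β(⅓,½)⟧, ⟦π⟧]` decided (Theorem IX‴, II)

First DECIDED SECTOR of the Kontsevich–Zagier conjecture with an algebraic irrational point class
among the generators (rung S2 of paper §6octies): by the `√3`-chain
(`SoloInformedIsogenyChain.lean`) the sector contains `⟦β(⅙,½)⟧ = ⟦[pt,√3]⟧⟦β(⅓,½)⟧`, and the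
relation `⟦β(⅙,½)⟧² = 3⟦β(⅓,½)⟧²` (`soloInformed_betaSixth_sq`) is DERIVED by the moves.

**Quadratic descent** (`soloInformed_evalP_eq_zero_of_mem_adjoin_quadratic`): if `evalP u, evalP v`
are algebraically independent over `ℚ`, `s² = d` in `P` and `evalP s = √d ∉ ℚ`, then `evalP` is
injective on `ℤ[s, u, v]` — every element is `p(u,v) + s·q(u,v)` (`s² = d`), the independence
extends to the real algebraic numbers `K ∋ √d` (Mathlib `AlgebraicIndependent.integralClosure`),
so `p + √d·q`, read as ONE polynomial over `K`, vanishes identically, and `√d ∉ ℚ` kills it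
coefficientwise.

**Theorem IX‴ (sector; unconditional).** With `B₃` pinned as `β(⅓,½)`: `evalP` is injective on
`ℤ[⟦[pt,√3]⟧, ⟦B₃⟧, ⟦π⟧]` (`soloInformed_evalP_eq_zero_of_mem_isogenySector`; input: Chudnovsky's
theorem on `π, Γ(⅓)` through Theorem IX″, and `√3 ∉ ℚ`), hence the period conjecture holds for
all representations with classes in this sector (`soloInformed_kzp_on_isogenySector`), which
contains `⟦β(⅙,½)⟧` (`soloInformed_betaSixth_mem_isogenySector`).
Residency `solo-KontsevichZagierPeriods-informed` (s22); paper §6octies.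

References: M. Kontsevich, D. Zagier, *Periods* (2001), §1.2; G. V. Chudnovsky (1984), Ch. 7;
M. Waldschmidt, *Elliptic functions and transcendence* (2008), Cor. 33.
-/

noncomputable section

open MeasureTheory Set Filter
namespace Summit.KontsevichZagierPeriods.KontsevichZagierPeriods.Theorems

open Literature.NumberTheory.Transcendental Literature.NumberTheory.Transcendental.KZ
open Literature.ModelTheory.ExponentialFields

/-! ### Quadratic descent: `KZP` on `ℤ[s, u, v]` with `s² = d`, `√d ∉ ℚ`, `u, v` independent -/

/-- **Normal form in `ℤ[s, u, v]` when `s² = d ∈ ℕ`**: every element is `p(u,v) + s·q(u,v)` with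
`p, q ∈ ℤ[X, Y]`. [folklore] -/
theorem soloInformed_exists_normalForm_adjoin_quadratic {s u v : FormalPeriodRing} (d : ℕ)
    (hs : s * s = d) {x : FormalPeriodRing}
    (hx : x ∈ Algebra.adjoin ℤ ({s, u, v} : Set FormalPeriodRing)) :
    ∃ p q : MvPolynomial (Fin 2) ℤ,
      x = MvPolynomial.aeval ![u, v] p + s * MvPolynomial.aeval ![u, v] q := by
  induction hx using Algebra.adjoin_induction with
  | mem y hy =>
    rcases hy with rfl | rfl | rfl
    · exact ⟨0, 1, by simp⟩
    · exact ⟨MvPolynomial.X 0, 0, by simp⟩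
    · exact ⟨MvPolynomial.X 1, 0, by simp⟩
  | algebraMap r => exact ⟨MvPolynomial.C r, 0, by simp⟩
  | add y z _ _ hy hz =>
    obtain ⟨p, q, rfl⟩ := hy
    obtain ⟨p', q', rfl⟩ := hz
    exact ⟨p + p', q + q', by simp only [map_add]; ring⟩
  | mul y z _ _ hy hz =>
    obtain ⟨p, q, rfl⟩ := hy
    obtain ⟨p', q', rfl⟩ := hz
    refine ⟨p * p' + (d : MvPolynomial (Fin 2) ℤ) * (q * q'), p * q' + q * p', ?_⟩
    simp only [map_add, map_mul, map_natCast]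
    linear_combination (MvPolynomial.aeval ![u, v] q * MvPolynomial.aeval ![u, v] q') * hs

/-- **Quadratic descent.** If `evalP u, evalP v` are algebraically independent over `ℚ`,
`s² = d` in `P` with `evalP s = √d` irrational, then `evalP` is injective on `ℤ[s, u, v]`:
extend the independence to the real algebraic numbers `K` (Mathlib:
`AlgebraicIndependent.integralClosure`), read `p + √d q = 0` as the vanishing of ONE polynomial
with coefficients `p_m + √d q_m ∈ K`, and use `√d ∉ ℚ` coefficientwise. [folklore] -/
theorem soloInformed_evalP_eq_zero_of_mem_adjoin_quadratic {s u v : FormalPeriodRing} (d : ℕ)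
    (hd : Irrational (Real.sqrt d)) (hs : s * s = d) (hse : evalP s = Real.sqrt d)
    (h : AlgebraicIndependent ℚ ![evalP u, evalP v]) {x : FormalPeriodRing}
    (hx : x ∈ Algebra.adjoin ℤ ({s, u, v} : Set FormalPeriodRing)) (h0 : evalP x = 0) :
    x = 0 := by
  obtain ⟨p, q, rfl⟩ := soloInformed_exists_normalForm_adjoin_quadratic d hs hx
  set K := integralClosure ℚ ℝ with hKdef
  have hK : AlgebraicIndependent K ![evalP u, evalP v] := h.integralClosure
  have hmem : Real.sqrt d ∈ K := by
    refine (mem_integralClosure_iff ℚ ℝ).2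
      ⟨Polynomial.X ^ 2 - Polynomial.C (d : ℚ), Polynomial.monic_X_pow_sub_C _ two_ne_zero, ?_⟩
    simp [Real.sq_sqrt (Nat.cast_nonneg d)]
  set c : K := ⟨Real.sqrt d, hmem⟩ with hcdef
  set P : MvPolynomial (Fin 2) K := MvPolynomial.map (algebraMap ℤ K) p +
    MvPolynomial.C c * MvPolynomial.map (algebraMap ℤ K) q with hPdef
  have hfun : (fun i => evalP (![u, v] i)) = ![evalP u, evalP v] := by
    ext i
    fin_cases i <;> rfl
  have hPeval : MvPolynomial.aeval ![evalP u, evalP v] P = 0 := by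
    rw [hPdef, map_add, map_mul, MvPolynomial.aeval_map_algebraMap,
      MvPolynomial.aeval_map_algebraMap, MvPolynomial.aeval_C]
    have hc : algebraMap K ℝ c = Real.sqrt d := rfl
    rw [hc, ← hfun, ← soloInformed_evalP_aeval, ← soloInformed_evalP_aeval, ← hse, ← map_mul,
      ← map_add]
    exact h0
  have hP0 : P = 0 := hK.eq_zero_of_aeval_eq_zero _ hPeval
  have hcoef : ∀ m, p.coeff m = 0 ∧ q.coeff m = 0 := by
    intro m
    have hm := congr_arg (MvPolynomial.coeff m) hP0
    rw [hPdef, MvPolynomial.coeff_add, MvPolynomial.coeff_map, MvPolynomial.coeff_C_mul,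
      MvPolynomial.coeff_map, MvPolynomial.coeff_zero] at hm
    have hmR : ((p.coeff m : ℤ) : ℝ) + Real.sqrt d * ((q.coeff m : ℤ) : ℝ) = 0 := by
      have := congr_arg (algebraMap K ℝ) hm
      simpa [hcdef] using this
    by_cases hq : q.coeff m = 0
    · refine ⟨?_, hq⟩
      rw [hq] at hmR
      exact_mod_cast (by simpa using hmR : ((p.coeff m : ℤ) : ℝ) = 0)
    · exfalso
      have hq' : ((q.coeff m : ℤ) : ℝ) ≠ 0 := by exact_mod_cast hq
      refine hd.ne_rational (-(p.coeff m)) (q.coeff m) ?_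
      rw [eq_div_iff hq']
      push_cast
      linarith
  have hp : p = 0 := MvPolynomial.ext _ _ fun m => by simpa using (hcoef m).1
  have hq : q = 0 := MvPolynomial.ext _ _ fun m => by simpa using (hcoef m).2
  simp [hp, hq]

/-! ### The first sector with an algebraic point: `ℤ[⟦[pt,√3]⟧, ⟦β(⅓,½)⟧, ⟦π⟧] ∋ ⟦β(⅙,½)⟧` -/

/-- `⟦[pt, √3]⟧² = 3` in the formal period ring (product move `⟦[pt,x]⟧⟦[pt,y]⟧ = ⟦[pt,xy]⟧`
and `⟦[pt, 3]⟧ = 3`). -/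
theorem soloInformed_sqrtThreeRep_mul_self :
    toFormalPeriod (of (IntegralRep.unit.constMul (Real.sqrt 3)
        (soloInformed_isAlgebraic_sqrt_natCast 3))) *
      toFormalPeriod (of (IntegralRep.unit.constMul (Real.sqrt 3)
        (soloInformed_isAlgebraic_sqrt_natCast 3))) = 3 := by
  have key : Real.sqrt 3 * Real.sqrt 3 = ((3 : ℕ) : ℝ) := by
    push_cast
    exact Real.mul_self_sqrt (by norm_num)
  have h33 : IsAlgebraic ℚ (Real.sqrt 3 * Real.sqrt 3) := by
    rw [key]
    exact isAlgebraic_nat 3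
  rw [soloInformed_pointRep_mul (Real.sqrt 3) (Real.sqrt 3) _ _ h33]
  have hrep : IntegralRep.unit.constMul (Real.sqrt 3 * Real.sqrt 3) h33 =
      IntegralRep.unit.constMul ((3 : ℕ) : ℝ) (isAlgebraic_nat 3) := by
    congr 1
  rw [hrep, toFormalPeriod_of_unit_constMul_natCast]
  push_cast
  rfl

/-- `evalP ⟦[pt, √3]⟧ = √3`. -/
theorem soloInformed_evalP_sqrtThreeRep :
    evalP (toFormalPeriod (of (IntegralRep.unit.constMul (Real.sqrt 3)
      (soloInformed_isAlgebraic_sqrt_natCast 3)))) = Real.sqrt 3 := by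
  rw [evalP_toFormalPeriod_of, IntegralRep.value_constMul, IntegralRep.value_unit, mul_one]

section IsogenySector

variable (B₃ B₆ : IntegralRep 1)

/-- **The isogeny sector** `ℤ[⟦[pt,√3]⟧, ⟦β(⅓,½)⟧, ⟦π⟧] ⊆ P` — the first sector of the formal
period ring with an ALGEBRAIC IRRATIONAL point class among its generators. -/
def soloInformedIsogenySector : Subalgebra ℤ FormalPeriodRing :=
  Algebra.adjoin ℤ {toFormalPeriod (of (IntegralRep.unit.constMul (Real.sqrt 3)
    (soloInformed_isAlgebraic_sqrt_natCast 3))), toFormalPeriod (of B₃), toFormalPeriod (of KZ.piRep)}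

/-- `⟦β(⅙,½)⟧` lies in the isogeny sector of `β(⅓,½)` (by the `√3`-chain). -/
theorem soloInformed_betaSixth_mem_isogenySector
    (hB₃d : B₃.domain = {t | t 0 ∈ Set.Ioo (0:ℝ) 1})
    (hB₃i : Set.EqOn B₃.integrand
      (fun t => (t 0) ^ (((1 / 3 : ℚ) : ℝ) - 1) * (1 - t 0) ^ (((1 / 2 : ℚ) : ℝ) - 1)) B₃.domain)
    (hB₆d : B₆.domain = {t | t 0 ∈ Set.Ioo (0:ℝ) 1})
    (hB₆i : Set.EqOn B₆.integrand
      (fun t => (t 0) ^ (((1 / 6 : ℚ) : ℝ) - 1) * (1 - t 0) ^ (((1 / 2 : ℚ) : ℝ) - 1)) B₆.domain) :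
    toFormalPeriod (of B₆) ∈ soloInformedIsogenySector B₃ := by
  rw [soloInformed_isogeny_chain B₃ B₆ hB₃d hB₃i hB₆d hB₆i]
  exact mul_mem (Algebra.subset_adjoin (by simp)) (Algebra.subset_adjoin (by simp))

/-- **The derived quadratic relation** `⟦β(⅙,½)⟧² = 3 ⟦β(⅓,½)⟧²` in `P`. -/
theorem soloInformed_betaSixth_sq
    (hB₃d : B₃.domain = {t | t 0 ∈ Set.Ioo (0:ℝ) 1})
    (hB₃i : Set.EqOn B₃.integrand
      (fun t => (t 0) ^ (((1 / 3 : ℚ) : ℝ) - 1) * (1 - t 0) ^ (((1 / 2 : ℚ) : ℝ) - 1)) B₃.domain)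
    (hB₆d : B₆.domain = {t | t 0 ∈ Set.Ioo (0:ℝ) 1})
    (hB₆i : Set.EqOn B₆.integrand
      (fun t => (t 0) ^ (((1 / 6 : ℚ) : ℝ) - 1) * (1 - t 0) ^ (((1 / 2 : ℚ) : ℝ) - 1)) B₆.domain) :
    toFormalPeriod (of B₆) ^ 2 = 3 * toFormalPeriod (of B₃) ^ 2 := by
  rw [soloInformed_isogeny_chain B₃ B₆ hB₃d hB₃i hB₆d hB₆i, mul_pow, sq (toFormalPeriod _),
    soloInformed_sqrtThreeRep_mul_self]

/-- **Injectivity of evaluation on the isogeny sector** (unconditional: Chudnovsky's theorem on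
`π, Γ(⅓)` via Theorem IX″, quadratic descent along `√3 ∉ ℚ`): every integer polynomial relation
among `√3, B(⅓,½), π` — in particular `B(⅙,½)² = 3B(⅓,½)²` — is derivable by the moves. -/
theorem soloInformed_evalP_eq_zero_of_mem_isogenySector
    (hB₃d : B₃.domain = {t | t 0 ∈ Set.Ioo (0:ℝ) 1})
    (hB₃i : Set.EqOn B₃.integrand
      (fun t => (t 0) ^ (((1 / 3 : ℚ) : ℝ) - 1) * (1 - t 0) ^ (((1 / 2 : ℚ) : ℝ) - 1)) B₃.domain)
    {x : FormalPeriodRing} (hx : x ∈ soloInformedIsogenySector B₃) (h0 : evalP x = 0) :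
    x = 0 := by
  have hind : AlgebraicIndependent ℚ
      ![evalP (toFormalPeriod (of B₃)), evalP (toFormalPeriod (of KZ.piRep))] := by
    rw [evalP_toFormalPeriod_of, evalP_toFormalPeriod_of, piRep_value]
    exact soloInformed_algebraicIndependent_betaThirdHalf_pi B₃ hB₃d hB₃i
  have hse : evalP (toFormalPeriod (of (IntegralRep.unit.constMul (Real.sqrt 3)
      (soloInformed_isAlgebraic_sqrt_natCast 3)))) = Real.sqrt ((3 : ℕ) : ℝ) := by
    rw [soloInformed_evalP_sqrtThreeRep]
    norm_num
  have hs := soloInformed_sqrtThreeRep_mul_self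
  rw [show (3 : FormalPeriodRing) = ((3 : ℕ) : FormalPeriodRing) by norm_num] at hs
  have hd : Irrational (Real.sqrt ((3 : ℕ) : ℝ)) := Nat.prime_three.irrational_sqrt
  exact soloInformed_evalP_eq_zero_of_mem_adjoin_quadratic 3 hd hs hse hind hx h0

/-- **THEOREM IX‴ (the isogeny sector decided, unconditionally).** The Kontsevich–Zagier period
conjecture holds for all representations whose classes lie in
`ℤ[⟦[pt,√3]⟧, ⟦β(⅓,½)⟧, ⟦π⟧] ∋ ⟦β(⅙,½)⟧, ⟦β(⅚,½)⟧·(…)`: equal values ⇒ equivalent by the moves. -/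
theorem soloInformed_kzp_on_isogenySector
    (hB₃d : B₃.domain = {t | t 0 ∈ Set.Ioo (0:ℝ) 1})
    (hB₃i : Set.EqOn B₃.integrand
      (fun t => (t 0) ^ (((1 / 3 : ℚ) : ℝ) - 1) * (1 - t 0) ^ (((1 / 2 : ℚ) : ℝ) - 1)) B₃.domain)
    {n m : ℕ} (r : IntegralRep n) (r' : IntegralRep m)
    (hr : toFormalPeriod (of r) ∈ soloInformedIsogenySector B₃)
    (hr' : toFormalPeriod (of r') ∈ soloInformedIsogenySector B₃)
    (hv : r.value = r'.value) : Equivalent r r' := by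
  have hx := sub_mem hr hr'
  have h0 : evalP (toFormalPeriod (of r) - toFormalPeriod (of r')) = 0 := by
    rw [map_sub, evalP_toFormalPeriod_of, evalP_toFormalPeriod_of, hv, sub_self]
  have h := soloInformed_evalP_eq_zero_of_mem_isogenySector B₃ hB₃d hB₃i hx h0
  exact toFormalPeriod_eq_iff.mp (sub_eq_zero.mp h)

/-- **Corollary**: `β(⅙,½)` and `β(⅓,½)` themselves satisfy the conjecture inside the sector —
e.g. `β(⅙,½) ≁ β(⅓,½)` is witnessed by values, while `β(⅙,½)² ∼ 3β(⅓,½)²` (as classes) is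
DERIVED (`soloInformed_betaSixth_sq`). Recorded instance: any `r, r'` with classes
`⟦β(⅙,½)⟧²` and `3⟦β(⅓,½)⟧²` are equivalent. -/
theorem soloInformed_equivalent_of_classes_betaSixth_sq
    (hB₃d : B₃.domain = {t | t 0 ∈ Set.Ioo (0:ℝ) 1})
    (hB₃i : Set.EqOn B₃.integrand
      (fun t => (t 0) ^ (((1 / 3 : ℚ) : ℝ) - 1) * (1 - t 0) ^ (((1 / 2 : ℚ) : ℝ) - 1)) B₃.domain)
    (hB₆d : B₆.domain = {t | t 0 ∈ Set.Ioo (0:ℝ) 1})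
    (hB₆i : Set.EqOn B₆.integrand
      (fun t => (t 0) ^ (((1 / 6 : ℚ) : ℝ) - 1) * (1 - t 0) ^ (((1 / 2 : ℚ) : ℝ) - 1)) B₆.domain)
    {n m : ℕ} (r : IntegralRep n) (r' : IntegralRep m)
    (hr : toFormalPeriod (of r) = toFormalPeriod (of B₆) ^ 2)
    (hr' : toFormalPeriod (of r') = 3 * toFormalPeriod (of B₃) ^ 2) : Equivalent r r' := by
  apply toFormalPeriod_eq_iff.mp
  rw [hr, hr', soloInformed_betaSixth_sq B₃ B₆ hB₃d hB₃i hB₆d hB₆i]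

end IsogenySector

end Summit.KontsevichZagierPeriods.KontsevichZagierPeriods.Theorems

end
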